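import Summits.CriticalPhenomena.PercolationContinuityZ3.Theorems.PercNearOneGluingAdditiveGluingKnThm2Refined
import HarnessLib

/-! # Crux `PercNearOneGluing.NoHeavyLowerTail` (stmt-CriticalPhenomena-4575) — k-relay EVENT GLUING `EG_k` (sharp constant 1)
# from ONE residual row: the k-uniform refined Kozma–Nitzan certificate `(KNS')_k` (new-inequality factory, seat `prim-ineq-gen-7`)

Support file (`--supports stmt-CriticalPhenomena-4575`); no definitions, no named facts, no sorries.

Setting: `μ = prodBernoulli w` on `Fin n`, a finite relay set `A`, a DESIGNATED relay `r ∈ A` (the factory uses the worst one), an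
observer `o ∉ A`, a sink `c`.  The event gluing `EG_k` at `r` is `μ({o ↔ A} ∩ {o ↮ c}) ≤ μ{r ↮ c}`; for every `k` and constant `1` it is the
hypothesis of the landed `Theorems.noHeavyLowerTail_of_eventGluingConst` (with `C = 1`), i.e. it closes the crux.  `k = 3` is the landed
`Theorems.EG3Residual.eg3_of_refinedResidual` (prove-4); THIS FILE is the k-UNIFORM version.

Write `X := μ(o↔A, o↔c) − μ(o↔A, r↔c)` and, for every nonempty `O ⊆ A ∖ {r}`, the refined conditioning event
`N'_O := {O ∪ {o} ↮ A ∖ O}` (note `r ∈ A ∖ O`).  The k-relay version of Kozma–Nitzan's decomposition (arXiv:2401.12397, Thm. 2, pp. 8–9) is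
  `X = Σ_{∅ ≠ O ⊆ A∖r} (T_O − U_O)`,  `T_O = μ(N'_O ∩ {o ↔ O} ∩ {c ↔ all of O})`,  `U_O = μ(N'_O ∩ {o ↔ O} ∩ {c ↔ all of A ∖ O})`
(`egk_split`: the plus terms are indexed by `C_o ∩ A = O`, the minus terms by `C_c ∩ A = A ∖ O`), and the two van den Berg–Häggström–Kahn
steps per `O` (BHK 2006 Thms. 1.3/1.4 for the clusters of the SETS `O ∪ {o}` and `A ∖ O`, landed as `stub_bhkSets`, used through
`knRef_bhkOne/knRef_bhkTwo`) give `T_O ≥ φ'_O m'_O`, `U_O ≤ φ'_O m'_{A∖O}` with `φ'_O = μ(N'_O ∩ {o↔O}) / μ(N'_O)`,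
`m'_T = μ(N'_O ∩ {c ↔ all of T})`.  Since `μ{r ↮ c} − μ({o↔A} ∩ {o↮c}) = X + s`, `s := μ({o ↮ A} ∩ {r ↮ c})` (`egk_margin_eq`):

* `eventGluing_of_refinedResidual` — **if `(KNS')_k :  s + Σ_{∅≠O⊆A∖r} φ'_O (m'_O − m'_{A∖O}) ≥ 0` then `μ({o↔A} ∩ {o↮c}) ≤ μ{r↮c}`**
  (all `μ(N'_O) > 0`; the residual is a law-level polynomial inequality in the connection pattern of `A ∪ {o, c}`).

Status of the row `(KNS')_k` (CONJECTURAL, not proved here): 0 violations on exact graph laws for k = 3…6 (prim-ineq-gen-6) and in targeted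
adversarial climbs on graph AND hypergraph percolation laws for k = 3, 4 (this seat, memo run/shared/lean/prim/prim-ineq-gen-7/FINDING-HYPER.md);
the UNREFINED row `(KNS)_k` (conditioning on `{O ↮ A∖O}` only) is false for hypergraph percolation already at k = 3, hence not a consequence of
cluster-exchange rows — which is why the refined form is the one typed here.
[cite: KozmaNitzan2024, Theorem 2 (§3.1, pp. 8–9); VandenbergHaggstromKahn2005, Thms. 1.3–1.4 (pp. 6–7)]
-/

namespace Summit.CriticalPhenomena.PercolationContinuityZ3.Theorems

open MeasureTheory Set Literature.Probability.LatticeModels Literature.Probability.Percolation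
open SimpleGraph (Reachable)

noncomputable section
open Classical

variable {n : ℕ}

namespace EGkResidual

/-! ### Combinatorics of the split `X = Σ_O (T_O − U_O)` -/

/-- The plus event `{o ↔ A} ∩ {o ↔ c} ∩ {r ↮ c}` is the disjoint union over `∅ ≠ O ⊆ A ∖ r` (`O = C_o ∩ A`) of
`N'_O ∩ {o ↔ O} ∩ {c ↔ all of O}`. [cite: KozmaNitzan2024, Theorem 2 (proof, p. 8)] -/
theorem plus_eq_biUnion (A : Finset (Fin n)) (o c r : Fin n) (hr : r ∈ A) :
    ((⋃ a ∈ A, (openConn o a : Set (BondConfig (Fin n)))) ∩ openConn o c ∩ (openConn r c)ᶜ) =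
      ⋃ O ∈ (A.erase r).powerset.filter (fun O => O.Nonempty),
        ({ω : BondConfig (Fin n) | ∀ s ∈ insert o O, ∀ x ∈ A \ O, ¬ (openGraph ω).Reachable s x} ∩
          ((⋃ s ∈ O, (openConn s o : Set (BondConfig (Fin n)))) ∩ ⋂ s ∈ O, (openConn s c : Set (BondConfig (Fin n))))) := by
  ext ω
  simp only [Set.mem_inter_iff, Set.mem_iUnion, Set.mem_compl_iff, Set.mem_iInter, Set.mem_setOf_eq, exists_prop,
    Finset.mem_filter, Finset.mem_powerset]
  constructor
  · rintro ⟨⟨⟨a, haA, hoa⟩, hoc⟩, hrc⟩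
    refine ⟨(A.erase r).filter (fun s => (openGraph ω).Reachable o s), ⟨Finset.filter_subset _ _, ?_⟩, ?_, ?_, ?_⟩
    · refine ⟨a, Finset.mem_filter.2 ⟨Finset.mem_erase.2 ⟨?_, haA⟩, hoa⟩⟩
      rintro rfl
      exact hrc (hoa.symm.trans hoc)
    · intro s hs x hx
      rcases Finset.mem_sdiff.1 hx with ⟨hxA, hxO⟩
      have hox : ¬ (openGraph ω).Reachable o x := by
        intro h
        by_cases hxr : x = r
        · subst hxr; exact hrc (h.symm.trans hoc)
        · exact hxO (Finset.mem_filter.2 ⟨Finset.mem_erase.2 ⟨hxr, hxA⟩, h⟩)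
      rcases Finset.mem_insert.1 hs with rfl | hsO
      · exact hox
      · intro h
        exact hox (((Finset.mem_filter.1 hsO).2).trans h)
    · exact ⟨a, Finset.mem_filter.2 ⟨Finset.mem_erase.2 ⟨by rintro rfl; exact hrc (hoa.symm.trans hoc), haA⟩, hoa⟩, hoa.symm⟩
    · intro s hs
      exact ((Finset.mem_filter.1 hs).2).symm.trans hoc
  · rintro ⟨O, ⟨hOsub, hOne⟩, hN, ⟨s, hsO, hso⟩, hc⟩
    have hsA : s ∈ A := Finset.mem_of_mem_erase (hOsub hsO)
    have hrAO : r ∈ A \ O := Finset.mem_sdiff.2 ⟨hr, fun h => (Finset.mem_erase.1 (hOsub h)).1 rfl⟩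
    refine ⟨⟨⟨s, hsA, hso.symm⟩, hso.symm.trans (hc s hsO)⟩, fun hrc => ?_⟩
    exact hN o (Finset.mem_insert_self o O) r hrAO ((hso.symm.trans (hc s hsO)).trans hrc.symm)

/-- The minus event `{o ↔ A} ∩ {r ↔ c} ∩ {o ↮ c}` is the disjoint union over `∅ ≠ O ⊆ A ∖ r` (`A ∖ O = C_c ∩ A`) of
`N'_O ∩ {o ↔ O} ∩ {c ↔ all of A ∖ O}`. [cite: KozmaNitzan2024, Theorem 2 (proof, p. 8)] -/
theorem minus_eq_biUnion (A : Finset (Fin n)) (o c r : Fin n) (hr : r ∈ A) :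
    ((⋃ a ∈ A, (openConn o a : Set (BondConfig (Fin n)))) ∩ openConn r c ∩ (openConn o c)ᶜ) =
      ⋃ O ∈ (A.erase r).powerset.filter (fun O => O.Nonempty),
        ({ω : BondConfig (Fin n) | ∀ s ∈ insert o O, ∀ x ∈ A \ O, ¬ (openGraph ω).Reachable s x} ∩
          ((⋃ s ∈ O, (openConn s o : Set (BondConfig (Fin n)))) ∩ ⋂ s ∈ A \ O, (openConn s c : Set (BondConfig (Fin n))))) := by
  ext ω
  simp only [Set.mem_inter_iff, Set.mem_iUnion, Set.mem_compl_iff, Set.mem_iInter, Set.mem_setOf_eq, exists_prop,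
    Finset.mem_filter, Finset.mem_powerset]
  constructor
  · rintro ⟨⟨⟨a, haA, hoa⟩, hrc⟩, hoc⟩
    have har : a ≠ r := by rintro rfl; exact hoc (hoa.trans hrc)
    have hac : ¬ (openGraph ω).Reachable a c := fun h => hoc (hoa.trans h)
    refine ⟨(A.erase r).filter (fun s => ¬ (openGraph ω).Reachable s c), ⟨Finset.filter_subset _ _, ?_⟩, ?_, ?_, ?_⟩
    · exact ⟨a, Finset.mem_filter.2 ⟨Finset.mem_erase.2 ⟨har, haA⟩, hac⟩⟩
    · intro s hs x hx
      rcases Finset.mem_sdiff.1 hx with ⟨hxA, hxO⟩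
      have hxc : (openGraph ω).Reachable x c := by
        by_cases hxr : x = r
        · subst hxr; exact hrc
        · by_contra h
          exact hxO (Finset.mem_filter.2 ⟨Finset.mem_erase.2 ⟨hxr, hxA⟩, h⟩)
      rcases Finset.mem_insert.1 hs with rfl | hsO
      · exact fun h => hoc (h.trans hxc)
      · exact fun h => (Finset.mem_filter.1 hsO).2 (h.trans hxc)
    · exact ⟨a, Finset.mem_filter.2 ⟨Finset.mem_erase.2 ⟨har, haA⟩, hac⟩, hoa.symm⟩
    · intro s hs
      rcases Finset.mem_sdiff.1 hs with ⟨hsA, hsO⟩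
      by_cases hsr : s = r
      · subst hsr; exact hrc
      · by_contra h
        exact hsO (Finset.mem_filter.2 ⟨Finset.mem_erase.2 ⟨hsr, hsA⟩, h⟩)
  · rintro ⟨O, ⟨hOsub, hOne⟩, hN, ⟨s, hsO, hso⟩, hc⟩
    have hsA : s ∈ A := Finset.mem_of_mem_erase (hOsub hsO)
    have hrAO : r ∈ A \ O := Finset.mem_sdiff.2 ⟨hr, fun h => (Finset.mem_erase.1 (hOsub h)).1 rfl⟩
    refine ⟨⟨⟨s, hsA, hso.symm⟩, hc r hrAO⟩, fun hoc => ?_⟩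
    exact hN o (Finset.mem_insert_self o O) r hrAO (hoc.trans (hc r hrAO).symm)

/-- On a plus piece the index is determined: `O = {s ∈ A ∖ r | o ↔ s}`. [folklore] -/
theorem plus_index_eq (A O : Finset (Fin n)) (o c r : Fin n) (hOsub : O ⊆ A.erase r) (ω : BondConfig (Fin n))
    (hN : ∀ s ∈ insert o O, ∀ x ∈ A \ O, ¬ (openGraph ω).Reachable s x)
    (hs : ∃ s ∈ O, (openGraph ω).Reachable s o) (hc : ∀ s ∈ O, (openGraph ω).Reachable s c) :
    O = (A.erase r).filter (fun s => (openGraph ω).Reachable o s) := by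
  obtain ⟨s₀, hs₀, hs₀o⟩ := hs
  ext s
  simp only [Finset.mem_filter]
  constructor
  · intro hsO
    exact ⟨hOsub hsO, (hs₀o.symm.trans (hc s₀ hs₀)).trans (hc s hsO).symm⟩
  · rintro ⟨hsA, hos⟩
    by_contra hsO
    exact hN o (Finset.mem_insert_self o O) s (Finset.mem_sdiff.2 ⟨Finset.mem_of_mem_erase hsA, hsO⟩) hos

/-- On a minus piece the index is determined: `O = {s ∈ A ∖ r | s ↮ c}`. [folklore] -/
theorem minus_index_eq (A O : Finset (Fin n)) (o c r : Fin n) (hOsub : O ⊆ A.erase r) (ω : BondConfig (Fin n))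
    (hN : ∀ s ∈ insert o O, ∀ x ∈ A \ O, ¬ (openGraph ω).Reachable s x)
    (hc : ∀ s ∈ A \ O, (openGraph ω).Reachable s c) (hr : r ∈ A) :
    O = (A.erase r).filter (fun s => ¬ (openGraph ω).Reachable s c) := by
  have hrAO : r ∈ A \ O := Finset.mem_sdiff.2 ⟨hr, fun h => (Finset.mem_erase.1 (hOsub h)).1 rfl⟩
  ext s
  simp only [Finset.mem_filter]
  constructor
  · intro hsO
    exact ⟨hOsub hsO, fun h => hN s (Finset.mem_insert_of_mem hsO) r hrAO (h.trans (hc r hrAO).symm)⟩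
  · rintro ⟨hsA, hsc⟩
    by_contra hsO
    exact hsc (hc s (Finset.mem_sdiff.2 ⟨Finset.mem_of_mem_erase hsA, hsO⟩))

/-- The plus pieces are pairwise disjoint. [folklore] -/
theorem plus_pairwiseDisjoint (A : Finset (Fin n)) (o c r : Fin n) :
    (↑((A.erase r).powerset.filter (fun O => O.Nonempty)) : Set (Finset (Fin n))).PairwiseDisjoint
      (fun O => ({ω : BondConfig (Fin n) | ∀ s ∈ insert o O, ∀ x ∈ A \ O, ¬ (openGraph ω).Reachable s x} ∩
          ((⋃ s ∈ O, (openConn s o : Set (BondConfig (Fin n)))) ∩ ⋂ s ∈ O, (openConn s c : Set (BondConfig (Fin n)))))) := by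
  intro O₁ h₁ O₂ h₂ hne
  rw [Function.onFun, Set.disjoint_left]
  intro ω hω₁ hω₂
  simp only [Finset.coe_filter, Finset.mem_powerset, Set.mem_setOf_eq] at h₁ h₂
  simp only [Set.mem_inter_iff, Set.mem_iUnion, Set.mem_iInter, Set.mem_setOf_eq, exists_prop] at hω₁ hω₂
  apply hne
  rw [plus_index_eq A O₁ o c r h₁.1 ω hω₁.1 hω₁.2.1 hω₁.2.2, plus_index_eq A O₂ o c r h₂.1 ω hω₂.1 hω₂.2.1 hω₂.2.2]

/-- The minus pieces are pairwise disjoint. [folklore] -/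
theorem minus_pairwiseDisjoint (A : Finset (Fin n)) (o c r : Fin n) (hr : r ∈ A) :
    (↑((A.erase r).powerset.filter (fun O => O.Nonempty)) : Set (Finset (Fin n))).PairwiseDisjoint
      (fun O => ({ω : BondConfig (Fin n) | ∀ s ∈ insert o O, ∀ x ∈ A \ O, ¬ (openGraph ω).Reachable s x} ∩
          ((⋃ s ∈ O, (openConn s o : Set (BondConfig (Fin n)))) ∩ ⋂ s ∈ A \ O, (openConn s c : Set (BondConfig (Fin n)))))) := by
  intro O₁ h₁ O₂ h₂ hne
  rw [Function.onFun, Set.disjoint_left]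
  intro ω hω₁ hω₂
  simp only [Finset.coe_filter, Finset.mem_powerset, Set.mem_setOf_eq] at h₁ h₂
  simp only [Set.mem_inter_iff, Set.mem_iUnion, Set.mem_iInter, Set.mem_setOf_eq, exists_prop] at hω₁ hω₂
  apply hne
  rw [minus_index_eq A O₁ o c r h₁.1 ω hω₁.1 hω₁.2.2 hr, minus_index_eq A O₂ o c r h₂.1 ω hω₂.1 hω₂.2.2 hr]

/-! ### Measure bookkeeping -/

/-- **The k-relay Kozma–Nitzan split** `X = Σ_{∅≠O⊆A∖r} (T_O − U_O)`. [cite: KozmaNitzan2024, Theorem 2 (proof, pp. 8–9)] -/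
theorem split (w : Sym2 (Fin n) → unitInterval) (A : Finset (Fin n)) (o c r : Fin n) (hr : r ∈ A) :
    (prodBernoulli w).real ((⋃ a ∈ A, (openConn o a : Set (BondConfig (Fin n)))) ∩ openConn o c)
      - (prodBernoulli w).real ((⋃ a ∈ A, (openConn o a : Set (BondConfig (Fin n)))) ∩ openConn r c)
    = ∑ O ∈ (A.erase r).powerset.filter (fun O => O.Nonempty),
        ((prodBernoulli w).real
            ({ω : BondConfig (Fin n) | ∀ s ∈ insert o O, ∀ x ∈ A \ O, ¬ (openGraph ω).Reachable s x} ∩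
              ((⋃ s ∈ O, (openConn s o : Set (BondConfig (Fin n)))) ∩ ⋂ s ∈ O, (openConn s c : Set (BondConfig (Fin n)))))
          - (prodBernoulli w).real
            ({ω : BondConfig (Fin n) | ∀ s ∈ insert o O, ∀ x ∈ A \ O, ¬ (openGraph ω).Reachable s x} ∩
              ((⋃ s ∈ O, (openConn s o : Set (BondConfig (Fin n)))) ∩ ⋂ s ∈ A \ O, (openConn s c : Set (BondConfig (Fin n)))))) := by
  have hm : ∀ s : Set (BondConfig (Fin n)), MeasurableSet s := fun _ => MeasurableSet.of_discrete
  set μ := prodBernoulli w with hμ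
  set E : Set (BondConfig (Fin n)) := ⋃ a ∈ A, (openConn o a : Set (BondConfig (Fin n))) with hE
  have e1 : μ.real (E ∩ openConn o c ∩ openConn r c) + μ.real ((E ∩ openConn o c) \ openConn r c) = μ.real (E ∩ openConn o c) :=
    measureReal_inter_add_sdiff (hm _) (measure_ne_top _ _)
  have e2 : μ.real (E ∩ openConn r c ∩ openConn o c) + μ.real ((E ∩ openConn r c) \ openConn o c) = μ.real (E ∩ openConn r c) :=
    measureReal_inter_add_sdiff (hm _) (measure_ne_top _ _)
  have e3 : E ∩ openConn o c ∩ openConn r c = E ∩ openConn r c ∩ openConn o c := Set.inter_right_comm _ _ _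
  have hplus : μ.real ((E ∩ openConn o c) \ openConn r c) = ∑ O ∈ (A.erase r).powerset.filter (fun O => O.Nonempty),
      μ.real ({ω : BondConfig (Fin n) | ∀ s ∈ insert o O, ∀ x ∈ A \ O, ¬ (openGraph ω).Reachable s x} ∩
        ((⋃ s ∈ O, (openConn s o : Set (BondConfig (Fin n)))) ∩ ⋂ s ∈ O, (openConn s c : Set (BondConfig (Fin n))))) := by
    rw [Set.sdiff_eq, hE, plus_eq_biUnion A o c r hr]
    exact measureReal_biUnion_finset (plus_pairwiseDisjoint A o c r) (fun _ _ => hm _) (fun _ _ => measure_ne_top _ _)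
  have hminus : μ.real ((E ∩ openConn r c) \ openConn o c) = ∑ O ∈ (A.erase r).powerset.filter (fun O => O.Nonempty),
      μ.real ({ω : BondConfig (Fin n) | ∀ s ∈ insert o O, ∀ x ∈ A \ O, ¬ (openGraph ω).Reachable s x} ∩
        ((⋃ s ∈ O, (openConn s o : Set (BondConfig (Fin n)))) ∩ ⋂ s ∈ A \ O, (openConn s c : Set (BondConfig (Fin n))))) := by
    rw [Set.sdiff_eq, hE, minus_eq_biUnion A o c r hr]
    exact measureReal_biUnion_finset (minus_pairwiseDisjoint A o c r hr) (fun _ _ => hm _) (fun _ _ => measure_ne_top _ _)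
  rw [Finset.sum_sub_distrib, ← hplus, ← hminus]
  rw [e3] at e1
  linarith

/-- The event-gluing margin is `X` plus the slack: `μ{r ↮ c} − μ({o↔A} ∩ {o↮c}) = [μ(o↔A, o↔c) − μ(o↔A, r↔c)] + μ({o↮A} ∩ {r↮c})`. [folklore] -/
theorem margin_eq (w : Sym2 (Fin n) → unitInterval) (A : Finset (Fin n)) (o c r : Fin n) :
    (prodBernoulli w).real ((openConn r c : Set (BondConfig (Fin n)))ᶜ)
      - (prodBernoulli w).real ((⋃ a ∈ A, (openConn o a : Set (BondConfig (Fin n)))) ∩ (openConn o c)ᶜ)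
    = ((prodBernoulli w).real ((⋃ a ∈ A, (openConn o a : Set (BondConfig (Fin n)))) ∩ openConn o c)
        - (prodBernoulli w).real ((⋃ a ∈ A, (openConn o a : Set (BondConfig (Fin n)))) ∩ openConn r c))
      + (prodBernoulli w).real ((⋃ a ∈ A, (openConn o a : Set (BondConfig (Fin n))))ᶜ ∩ (openConn r c)ᶜ) := by
  have hm : ∀ s : Set (BondConfig (Fin n)), MeasurableSet s := fun _ => MeasurableSet.of_discrete
  set μ := prodBernoulli w with hμ
  set E : Set (BondConfig (Fin n)) := ⋃ a ∈ A, (openConn o a : Set (BondConfig (Fin n))) with hE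
  have e1 : μ.real (E ∩ openConn o c) + μ.real (E \ openConn o c) = μ.real E :=
    measureReal_inter_add_sdiff (hm _) (measure_ne_top _ _)
  have e2 : μ.real (E ∩ openConn r c) + μ.real (E \ openConn r c) = μ.real E :=
    measureReal_inter_add_sdiff (hm _) (measure_ne_top _ _)
  have e3 : μ.real ((openConn r c : Set (BondConfig (Fin n)))ᶜ ∩ E) + μ.real ((openConn r c : Set (BondConfig (Fin n)))ᶜ \ E)
      = μ.real ((openConn r c : Set (BondConfig (Fin n)))ᶜ) := measureReal_inter_add_sdiff (hm _) (measure_ne_top _ _)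
  have r1 : E \ openConn o c = E ∩ (openConn o c)ᶜ := Set.sdiff_eq _ _
  have r2 : (openConn r c : Set (BondConfig (Fin n)))ᶜ ∩ E = E \ openConn r c := by rw [Set.sdiff_eq, Set.inter_comm]
  have r3 : (openConn r c : Set (BondConfig (Fin n)))ᶜ \ E = Eᶜ ∩ (openConn r c)ᶜ := by rw [Set.sdiff_eq, Set.inter_comm]
  rw [r1] at e1
  rw [r2, r3] at e3
  linarith

/-- Coercion bookkeeping: the conditioning event written with `x ∈ ↑T` equals the one with `x ∈ T`. [folklore] -/
theorem sep_coe (S T : Finset (Fin n)) :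
    {ω : BondConfig (Fin n) | ∀ s ∈ S, ∀ x ∈ (↑T : Set (Fin n)), ¬ (openGraph ω).Reachable s x} =
      {ω : BondConfig (Fin n) | ∀ s ∈ S, ∀ x ∈ T, ¬ (openGraph ω).Reachable s x} := by
  ext ω
  simp only [Set.mem_setOf_eq, Finset.mem_coe]

/-- Real arithmetic of one term: `A m₁ ≤ P T`, `P U ≤ A m₂`, `P > 0` give `(A/P)(m₁ − m₂) ≤ T − U`. [folklore] -/
theorem term_arith {T U P A m₁ m₂ : ℝ} (hP : 0 < P) (h1 : A * m₁ ≤ P * T) (h2 : P * U ≤ A * m₂) :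
    A / P * (m₁ - m₂) ≤ T - U := by
  rw [div_mul_eq_mul_div, div_le_iff₀ hP]
  nlinarith

/-- **The two refined BHK steps for one source set `O`**: `φ'_O (m'_O − m'_{A∖O}) ≤ T_O − U_O`.
[cite: VandenbergHaggstromKahn2005, Thms. 1.3–1.4 (pp. 6–7)] -/
theorem term_le (w : Sym2 (Fin n) → unitInterval) (A O : Finset (Fin n)) (o c : Fin n) (ho : o ∉ A)
    (hP : 0 < (prodBernoulli w).real {ω : BondConfig (Fin n) | ∀ s ∈ insert o O, ∀ x ∈ A \ O, ¬ (openGraph ω).Reachable s x}) :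
    (prodBernoulli w).real ({ω : BondConfig (Fin n) | ∀ s ∈ insert o O, ∀ x ∈ A \ O, ¬ (openGraph ω).Reachable s x} ∩
          ⋃ s ∈ O, (openConn s o : Set (BondConfig (Fin n))))
        / (prodBernoulli w).real {ω : BondConfig (Fin n) | ∀ s ∈ insert o O, ∀ x ∈ A \ O, ¬ (openGraph ω).Reachable s x}
        * ((prodBernoulli w).real ({ω : BondConfig (Fin n) | ∀ s ∈ insert o O, ∀ x ∈ A \ O, ¬ (openGraph ω).Reachable s x} ∩
              ⋂ s ∈ O, (openConn s c : Set (BondConfig (Fin n))))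
          - (prodBernoulli w).real ({ω : BondConfig (Fin n) | ∀ s ∈ insert o O, ∀ x ∈ A \ O, ¬ (openGraph ω).Reachable s x} ∩
              ⋂ s ∈ A \ O, (openConn s c : Set (BondConfig (Fin n)))))
      ≤ (prodBernoulli w).real ({ω : BondConfig (Fin n) | ∀ s ∈ insert o O, ∀ x ∈ A \ O, ¬ (openGraph ω).Reachable s x} ∩
            ((⋃ s ∈ O, (openConn s o : Set (BondConfig (Fin n)))) ∩ ⋂ s ∈ O, (openConn s c : Set (BondConfig (Fin n)))))
        - (prodBernoulli w).real ({ω : BondConfig (Fin n) | ∀ s ∈ insert o O, ∀ x ∈ A \ O, ¬ (openGraph ω).Reachable s x} ∩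
            ((⋃ s ∈ O, (openConn s o : Set (BondConfig (Fin n)))) ∩ ⋂ s ∈ A \ O, (openConn s c : Set (BondConfig (Fin n))))) := by
  have hsub : O ⊆ insert o O := Finset.subset_insert o O
  have hSX : ∀ s ∈ insert o O, s ∉ (↑(A \ O) : Set (Fin n)) := by
    intro s hs hx
    rw [Finset.mem_coe, Finset.mem_sdiff] at hx
    rcases Finset.mem_insert.1 hs with rfl | hsO
    · exact ho hx.1
    · exact hx.2 hsO
  have hdisj : Disjoint (insert o O) (A \ O) := by
    rw [Finset.disjoint_left]
    intro s hs hx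
    rw [Finset.mem_sdiff] at hx
    rcases Finset.mem_insert.1 hs with rfl | hsO
    · exact ho hx.1
    · exact hx.2 hsO
  have i1 := knRef_bhkOne stub_bhkSets.1 w (insert o O) O hsub (↑(A \ O) : Set (Fin n)) o c hSX
  rw [sep_coe] at i1
  have i2 := knRef_bhkTwo stub_bhkSets.2 w (insert o O) (A \ O) O (A \ O) hsub subset_rfl o c hdisj
  exact term_arith hP i1 i2

/-- **k-relay event gluing with constant 1 from the refined residual `(KNS')_k`** (`r ∈ A` designated, `o ∉ A`; all refined
conditioning events of positive mass).  If
`μ({o↮A} ∩ {r↮c}) + Σ_{∅≠O⊆A∖r} [μ(N'_O ∩ {o↔O}) / μ(N'_O)] · [μ(N'_O ∩ {c↔all O}) − μ(N'_O ∩ {c↔all A∖O})] ≥ 0`,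
`N'_O = {O ∪ {o} ↮ A ∖ O}`, then `μ({o↔A} ∩ {o↮c}) ≤ μ{r↮c}`.
[cite: KozmaNitzan2024, Theorem 2 (§3.1, pp. 8–9); VandenbergHaggstromKahn2005, Thms. 1.3–1.4 (pp. 6–7)] -/
theorem eventGluing_of_refinedResidual (w : Sym2 (Fin n) → unitInterval) (A : Finset (Fin n)) (o c r : Fin n)
    (hr : r ∈ A) (ho : o ∉ A)
    (hpos : ∀ O ∈ (A.erase r).powerset.filter (fun O => O.Nonempty),
      0 < (prodBernoulli w).real {ω : BondConfig (Fin n) | ∀ s ∈ insert o O, ∀ x ∈ A \ O, ¬ (openGraph ω).Reachable s x})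
    (hres : 0 ≤ (prodBernoulli w).real ((⋃ a ∈ A, (openConn o a : Set (BondConfig (Fin n))))ᶜ ∩ (openConn r c)ᶜ)
      + ∑ O ∈ (A.erase r).powerset.filter (fun O => O.Nonempty),
        (prodBernoulli w).real ({ω : BondConfig (Fin n) | ∀ s ∈ insert o O, ∀ x ∈ A \ O, ¬ (openGraph ω).Reachable s x} ∩
              ⋃ s ∈ O, (openConn s o : Set (BondConfig (Fin n))))
          / (prodBernoulli w).real {ω : BondConfig (Fin n) | ∀ s ∈ insert o O, ∀ x ∈ A \ O, ¬ (openGraph ω).Reachable s x}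
          * ((prodBernoulli w).real ({ω : BondConfig (Fin n) | ∀ s ∈ insert o O, ∀ x ∈ A \ O, ¬ (openGraph ω).Reachable s x} ∩
                ⋂ s ∈ O, (openConn s c : Set (BondConfig (Fin n))))
            - (prodBernoulli w).real ({ω : BondConfig (Fin n) | ∀ s ∈ insert o O, ∀ x ∈ A \ O, ¬ (openGraph ω).Reachable s x} ∩
                ⋂ s ∈ A \ O, (openConn s c : Set (BondConfig (Fin n)))))) :
    (prodBernoulli w).real ((⋃ a ∈ A, (openConn o a : Set (BondConfig (Fin n)))) ∩ (openConn o c)ᶜ) ≤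
      (prodBernoulli w).real ((openConn r c : Set (BondConfig (Fin n)))ᶜ) := by
  have hsplit := split w A o c r hr
  have hmargin := margin_eq w A o c r
  have hsum : ∑ O ∈ (A.erase r).powerset.filter (fun O => O.Nonempty),
        (prodBernoulli w).real ({ω : BondConfig (Fin n) | ∀ s ∈ insert o O, ∀ x ∈ A \ O, ¬ (openGraph ω).Reachable s x} ∩
              ⋃ s ∈ O, (openConn s o : Set (BondConfig (Fin n))))
          / (prodBernoulli w).real {ω : BondConfig (Fin n) | ∀ s ∈ insert o O, ∀ x ∈ A \ O, ¬ (openGraph ω).Reachable s x}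
          * ((prodBernoulli w).real ({ω : BondConfig (Fin n) | ∀ s ∈ insert o O, ∀ x ∈ A \ O, ¬ (openGraph ω).Reachable s x} ∩
                ⋂ s ∈ O, (openConn s c : Set (BondConfig (Fin n))))
            - (prodBernoulli w).real ({ω : BondConfig (Fin n) | ∀ s ∈ insert o O, ∀ x ∈ A \ O, ¬ (openGraph ω).Reachable s x} ∩
                ⋂ s ∈ A \ O, (openConn s c : Set (BondConfig (Fin n)))))
      ≤ ∑ O ∈ (A.erase r).powerset.filter (fun O => O.Nonempty),
        ((prodBernoulli w).real
            ({ω : BondConfig (Fin n) | ∀ s ∈ insert o O, ∀ x ∈ A \ O, ¬ (openGraph ω).Reachable s x} ∩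
              ((⋃ s ∈ O, (openConn s o : Set (BondConfig (Fin n)))) ∩ ⋂ s ∈ O, (openConn s c : Set (BondConfig (Fin n)))))
          - (prodBernoulli w).real
            ({ω : BondConfig (Fin n) | ∀ s ∈ insert o O, ∀ x ∈ A \ O, ¬ (openGraph ω).Reachable s x} ∩
              ((⋃ s ∈ O, (openConn s o : Set (BondConfig (Fin n)))) ∩ ⋂ s ∈ A \ O, (openConn s c : Set (BondConfig (Fin n)))))) := by
    exact Finset.sum_le_sum fun O hOI => term_le w A O o c ho (hpos O hOI)
  linarith

end EGkResidual

end

end Summit.CriticalPhenomena.PercolationContinuityZ3.Theorems
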